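import Summits.AtomisticToContinuum.BoseEinsteinCondensation.Theorems.BECGroundStateSOSPeriodicIRBoundZeroMomentumGapIntegrable
import Literature.MathematicalPhysics.QuantumManyBody.PeriodicClusteringFromKyFanGap
import Literature.MathematicalPhysics.QuantumManyBody.CondensateOccupationStability
import Literature.MathematicalPhysics.QuantumManyBody.PeriodicBoseGasFracEnergy
import Literature.MathematicalPhysics.QuantumManyBody.BoseGasDirichletWall
import HarnessLib

/-!
# Crux `PeriodicIRBound` (stmt-AtomisticToContinuum-3972), line `fsum-phase-pencil`, helper S5-C2
# `stub_fsumCouplingSelect` — the coupling-continuity SELECTION at fixed `(N, L)`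

Fix `N ≥ 1`, `L > 0`, a repulsive finite-range integrable pair potential `w` and thresholds `a < b < 1`.
Along the coupling path `t ↦ w_t := t·w` (`t ∈ [0,1]`, `w_t r = ENNReal.ofReal t * w r`) suppose the
condensate DICHOTOMY holds for the near-minimisers of every `H_t = ∑ -Δ + ∑ w_t^per`: at some slack `δ_t > 0`
every `δ_t`-near-minimiser `Ψ` has `n₀(Ψ) ≤ aN` or `n₀(Ψ) ≥ bN`. Then, granted the PATH TRANSPORT of
near-minimisers (hypothesis `(C1)` = the neighbouring stub `stub_fsumPathTransport`: near-minimisers of `H_{t'}`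
are near-minimisers of `H_t` for `t'` near `t`), the condensed branch is selected at `t = 1`: at some slack every
near-minimiser of `H_w` has `n₀ ≥ bN` (`CouplingSelect.couplingSelect`, registered stub `stub_fsumCouplingSelect`).

Proof (all at fixed `(N, L)`). With `P t` := "at some slack all near-minimisers of `H_t` have `n₀ ≥ bN`" and
`Q t` := "at some slack all have `n₀ ≤ aN`":

* ONE SIDE PER `t` (`CouplingSelect.oneSide`): `w_t` is again admissible and integrable, so `E₀(t) < ∞`
  (`periodicGroundStateEnergy_ne_top_of_integrable`) and the Ky Fan gap `2E₀(t) < kyFanTwo` holds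
  (`two_mul_periodicGroundStateEnergy_lt_kyFanTwo`, Faris–Simon nondegeneracy, in tree); the gap gives CLUSTERING of
  near-minimisers modulo a phase (`exists_phase_integral_norm_sub_sq_le_of_kyFanGap`, parallelogram law) and the
  `2N√η`-Lipschitz continuity of `n₀` (`PeriodicTrialState.condensateOccupation_le_add_of_phase_sq_dist_le`) makes
  the occupations of any two near-minimisers `(b - a)N/2`-close, so the dichotomy is resolved the same way for all
  of them: `P t ∨ Q t`;
* `P t ∧ Q t` is impossible (near-minimisers exist at every slack, `a < b`, `N ≥ 1`);
* `P` and `Q` are OPEN in `[0,1]` (path transport `(C1)`);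
* ANCHOR `P 0`: for the free gas `N ≤ n₀(Ψ) + (L²/4π²)·⟨Ψ, -ΔΨ⟩` (Parseval:
  `∑_p n_p = N`, `∑_p |2πp/L|² n_p = ∫|∇Ψ|²`), so small slack forces `n₀ ≥ bN` (`b < 1`);
* CONNECTEDNESS of `[0,1]` (`CouplingSelect.icc_select`: the indicator of `P` is continuous on `[0,1]` into the
  discrete space `Bool`, `isPreconnected_Icc`, `IsPreconnected.constant`): `P 1`, and `w_1 = w`.
-/

noncomputable section

open MeasureTheory Filter Topology
open scoped ENNReal NNReal ComplexConjugate BigOperators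

namespace Summit.AtomisticToContinuum.BoseEinsteinCondensation.Cruxes.PeriodicIRBound.FsumPhasePencil

open Literature.MathematicalPhysics.QuantumManyBody.BoseGas
open Summit.AtomisticToContinuum.BoseEinsteinCondensation.Cruxes.PeriodicIRBound.LinearPhFloorWagner
  (two_mul_periodicGroundStateEnergy_lt_kyFanTwo periodicGroundStateEnergy_ne_top_of_integrable)
open Summit.AtomisticToContinuum.BoseEinsteinCondensation.Cruxes.PeriodicIRBound.LinearPhFloorWagner.WF
  (lintegral_cellN_periodicInteraction_ne_top)

namespace CouplingSelect

variable {N : ℕ} {L : ℝ}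

/-! ## The selection principle on `[0,1]` (connectedness) -/

/-- **Selection on `[0,1]` by connectedness.** If two predicates `P, Q` on `[0,1]` cover it, never hold together,
are both open in `[0,1]`, and `P 0`, then `P 1`: the indicator of `P` is a continuous map of the preconnected set
`[0,1]` into the discrete space `Bool`, hence constant. [folklore] -/
theorem icc_select {P Q : ℝ → Prop}
    (hPQ : ∀ t ∈ Set.Icc (0 : ℝ) 1, P t ∨ Q t)
    (hdisj : ∀ t ∈ Set.Icc (0 : ℝ) 1, P t → Q t → False)
    (hP : ∀ t ∈ Set.Icc (0 : ℝ) 1, P t → ∃ θ : ℝ, 0 < θ ∧ ∀ t' ∈ Set.Icc (0 : ℝ) 1, |t' - t| < θ → P t')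
    (hQ : ∀ t ∈ Set.Icc (0 : ℝ) 1, Q t → ∃ θ : ℝ, 0 < θ ∧ ∀ t' ∈ Set.Icc (0 : ℝ) 1, |t' - t| < θ → Q t')
    (h0 : P 0) : P 1 := by
  classical
  -- the indicator of `P` is continuous on `[0,1]` into the discrete space `Bool`
  have hcont : ContinuousOn (fun t => decide (P t)) (Set.Icc (0 : ℝ) 1) := by
    intro t ht
    have hev : ∀ᶠ t' in 𝓝[Set.Icc (0 : ℝ) 1] t, decide (P t) = decide (P t') := by
      rcases hPQ t ht with hp | hq
      · obtain ⟨θ, hθ, hθP⟩ := hP t ht hp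
        filter_upwards [eventually_nhdsWithin_of_eventually_nhds (eventually_abs_sub_lt t hθ),
          eventually_mem_nhdsWithin] with t' h1 h2
        rw [decide_eq_decide]
        exact iff_of_true hp (hθP t' h2 h1)
      · obtain ⟨θ, hθ, hθQ⟩ := hQ t ht hq
        filter_upwards [eventually_nhdsWithin_of_eventually_nhds (eventually_abs_sub_lt t hθ),
          eventually_mem_nhdsWithin] with t' h1 h2
        rw [decide_eq_decide]
        exact iff_of_false (fun hp => hdisj t ht hp hq) fun hp' => hdisj t' h2 hp' (hθQ t' h2 h1)
    exact Filter.Tendsto.congr' hev tendsto_const_nhds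
  have h01 := isPreconnected_Icc.constant hcont (Set.left_mem_Icc.2 (zero_le_one' ℝ))
    (Set.right_mem_Icc.2 (zero_le_one' ℝ))
  rw [decide_eq_decide] at h01
  exact h01.1 h0

/-! ## The scaled potentials `w_t = t·w` are admissible -/

/-- `t·w` is again a repulsive finite-range profile. [folklore] -/
theorem isRepulsiveFiniteRange_ofReal_mul {w : ℝ → ℝ≥0∞} (hw : IsRepulsiveFiniteRange w) (t : ℝ) :
    IsRepulsiveFiniteRange (fun r => ENNReal.ofReal t * w r) := by
  obtain ⟨hmeas, R₀, hR₀⟩ := hw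
  exact ⟨measurable_const.mul hmeas, R₀, fun r hr => by simp only [hR₀ r hr, mul_zero]⟩

/-- `t·w` is again integrable: `∫ t·w(|x|) dx = t ∫ w(|x|) dx < ∞`. [folklore] -/
theorem lintegral_ofReal_mul_ne_top {w : ℝ → ℝ≥0∞} (hw : Measurable w) (hint : (∫⁻ x : Space, w ‖x‖) ≠ ⊤)
    (t : ℝ) : (∫⁻ x : Space, (fun r => ENNReal.ofReal t * w r) ‖x‖) ≠ ⊤ := by
  have hm : Measurable fun x : Space => w ‖x‖ := hw.comp measurable_norm
  show (∫⁻ x : Space, ENNReal.ofReal t * w ‖x‖) ≠ ⊤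
  rw [lintegral_const_mul _ hm]
  exact ENNReal.mul_ne_top ENNReal.ofReal_ne_top hint

/-! ## Per-potential facts at fixed `(N, L)` -/

/-- `E₀^per(N, L) < ∞` for an admissible integrable potential (`N ≥ 1`, `L > 0`). [folklore] -/
theorem groundStateEnergy_ne_top (hN : 1 ≤ N) (hL : 0 < L) {v : ℝ → ℝ≥0∞} (hv : IsRepulsiveFiniteRange v)
    (hint : (∫⁻ x : Space, v ‖x‖) ≠ ⊤) : periodicGroundStateEnergy v N L ≠ ⊤ :=
  periodicGroundStateEnergy_ne_top_of_integrable hv.1 hN hL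
    (lintegral_cellN_periodicInteraction_ne_top hL hv.1 hint N)

/-- Near-minimisers exist at every nonzero slack once `E₀^per < ∞` (infimum property). [folklore] -/
theorem exists_nearMinimiser_of_slack_ne_zero (v : ℝ → ℝ≥0∞) (hE : periodicGroundStateEnergy v N L ≠ ⊤)
    (δ : ℝ≥0∞) (hδ : δ ≠ 0) :
    ∃ Ψ : PeriodicTrialState N L, periodicEnergy v Ψ ≤ periodicGroundStateEnergy v N L + δ := by
  obtain ⟨Ψ, hΨ⟩ := iInf_lt_iff.1 (ENNReal.lt_add_right hE hδ)
  exact ⟨Ψ, hΨ.le⟩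

/-- `n₀(Ψ) < ∞` and `n₀(Ψ) ≤ N` (as a real number) for a periodic trial state (`∑_p n_p = N`). [folklore] -/
theorem condensateOccupation_ne_top_and_toReal_le (hL : 0 < L) (Ψ : PeriodicTrialState N L) :
    condensateOccupation N L Ψ.ψ ≠ ⊤ ∧ (condensateOccupation N L Ψ.ψ).toReal ≤ N := by
  have h : condensateOccupation N L Ψ.ψ ≤ N := by
    rw [← cellOccupation_planeWaveMode_zero]
    exact Ψ.cellOccupation_planeWaveMode_le hL 0
  refine ⟨ne_top_of_le_ne_top (ENNReal.natCast_ne_top N) h, ?_⟩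
  have h' := ENNReal.toReal_mono (ENNReal.natCast_ne_top N) h
  rwa [ENNReal.toReal_natCast] at h'

/-- **Occupation stability between two near-minimisers from a strict Ky Fan gap** (real form): if
`E₀ < ∞` and `2E₀ < kyFanTwo`, then for `ε > 0` some slack `δ > 0` makes any two `δ`-near-minimisers `Φ, Φ'`
satisfy `n₀(Φ') ≤ n₀(Φ) + 2Nε` — clustering `∫|Φ - e^{iθ}Φ'|² ≤ ε²` modulo a phase and the `2N√η`-Lipschitz
continuity of `n₀`. [folklore] -/
theorem toReal_condensateOccupation_le_add_of_gap (hL : 0 < L) {v : ℝ → ℝ≥0∞} (hv : Measurable v)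
    (hE : periodicGroundStateEnergy v N L ≠ ⊤)
    (hgap : 2 * periodicGroundStateEnergy v N L < kyFanTwo v N L) {ε : ℝ} (hε : 0 < ε) :
    ∃ δ : ℝ≥0∞, 0 < δ ∧ ∀ Φ Φ' : PeriodicTrialState N L,
      periodicEnergy v Φ ≤ periodicGroundStateEnergy v N L + δ →
      periodicEnergy v Φ' ≤ periodicGroundStateEnergy v N L + δ →
      (condensateOccupation N L Φ'.ψ).toReal ≤ (condensateOccupation N L Φ.ψ).toReal + 2 * N * ε := by
  -- a positive real gap
  obtain ⟨γ, hγ, hgap'⟩ : ∃ γ : ℝ, 0 < γ ∧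
      2 * periodicGroundStateEnergy v N L + ENNReal.ofReal γ ≤ kyFanTwo v N L := by
    obtain ⟨r, hr, hlt⟩ := ENNReal.lt_iff_exists_add_pos_lt.1 hgap
    exact ⟨r, NNReal.coe_pos.2 hr, by rw [ENNReal.ofReal_coe_nnreal]; exact hlt.le⟩
  obtain ⟨δ, hδ, hclus⟩ :=
    exists_phase_integral_norm_sub_sq_le_of_kyFanGap hv hγ hE hgap' (η := ε ^ 2) (by positivity)
  refine ⟨δ, hδ, fun Φ Φ' hΦ hΦ' => ?_⟩
  obtain ⟨θ, hθ⟩ := hclus Φ Φ' hΦ hΦ'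
  have hlip := PeriodicTrialState.condensateOccupation_le_add_of_phase_sq_dist_le hL Φ Φ' hθ
  rw [Real.sqrt_sq hε.le] at hlip
  have hfin := (condensateOccupation_ne_top_and_toReal_le hL Φ).1
  have h := ENNReal.toReal_mono (ENNReal.add_ne_top.2 ⟨hfin, ENNReal.ofReal_ne_top⟩) hlip
  rwa [ENNReal.toReal_add hfin ENNReal.ofReal_ne_top, ENNReal.toReal_ofReal (by positivity)] at h

/-- **One side per potential.** For an admissible integrable `v` at fixed `N ≥ 1`, `L > 0`: if at some slack
every near-minimiser has `n₀ ≤ aN` or `n₀ ≥ bN` (`a < b`), then at some (smaller) slack either ALL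
near-minimisers have `n₀ ≥ bN` or ALL have `n₀ ≤ aN` — the Ky Fan gap (`two_mul_periodicGroundStateEnergy_lt_kyFanTwo`)
makes the occupations of two near-minimisers `(b - a)N/2`-close. [folklore] -/
theorem oneSide (hN : 1 ≤ N) (hL : 0 < L) {v : ℝ → ℝ≥0∞} (hv : IsRepulsiveFiniteRange v)
    (hint : (∫⁻ x : Space, v ‖x‖) ≠ ⊤) {a b : ℝ} (hab : a < b)
    (hdich : ∃ δ : ℝ≥0∞, 0 < δ ∧ ∀ Ψ : PeriodicTrialState N L,
      periodicEnergy v Ψ ≤ periodicGroundStateEnergy v N L + δ →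
      (condensateOccupation N L Ψ.ψ).toReal ≤ a * N ∨ b * N ≤ (condensateOccupation N L Ψ.ψ).toReal) :
    (∃ δ : ℝ≥0∞, 0 < δ ∧ ∀ Ψ : PeriodicTrialState N L,
      periodicEnergy v Ψ ≤ periodicGroundStateEnergy v N L + δ →
      b * N ≤ (condensateOccupation N L Ψ.ψ).toReal) ∨
    (∃ δ : ℝ≥0∞, 0 < δ ∧ ∀ Ψ : PeriodicTrialState N L,
      periodicEnergy v Ψ ≤ periodicGroundStateEnergy v N L + δ →
      (condensateOccupation N L Ψ.ψ).toReal ≤ a * N) := by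
  obtain ⟨δd, hδd, hd⟩ := hdich
  have hE := groundStateEnergy_ne_top hN hL hv hint
  have hNpos : (0 : ℝ) < N := by exact_mod_cast hN
  have hbaN : 0 < (b - a) * N := mul_pos (sub_pos.2 hab) hNpos
  obtain ⟨δc, hδc, hc⟩ := toReal_condensateOccupation_le_add_of_gap hL hv.1 hE
    (two_mul_periodicGroundStateEnergy_lt_kyFanTwo hN hL hv hint) (ε := (b - a) / 4) (by linarith)
  have hδ : 0 < min δd δc := lt_min hδd hδc
  have hmon : ∀ {Ψ : PeriodicTrialState N L} {δ' : ℝ≥0∞},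
      periodicEnergy v Ψ ≤ periodicGroundStateEnergy v N L + min δd δc → min δd δc ≤ δ' →
      periodicEnergy v Ψ ≤ periodicGroundStateEnergy v N L + δ' :=
    fun h h' => h.trans (add_le_add le_rfl h')
  by_cases hex : ∃ Φ₀ : PeriodicTrialState N L,
      periodicEnergy v Φ₀ ≤ periodicGroundStateEnergy v N L + min δd δc ∧
      b * N ≤ (condensateOccupation N L Φ₀.ψ).toReal
  · obtain ⟨Φ₀, hΦ₀, hbΦ₀⟩ := hex
    refine Or.inl ⟨min δd δc, hδ, fun Ψ hΨ => ?_⟩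
    have hstab := hc Ψ Φ₀ (hmon hΨ (min_le_right _ _)) (hmon hΦ₀ (min_le_right _ _))
    refine (hd Ψ (hmon hΨ (min_le_left _ _))).resolve_left fun hle => ?_
    linarith
  · refine Or.inr ⟨min δd δc, hδ, fun Ψ hΨ => ?_⟩
    exact (hd Ψ (hmon hΨ (min_le_left _ _))).resolve_right fun hge => hex ⟨Ψ, hΨ, hge⟩

/-- The two sides exclude each other: near-minimisers exist at every slack and `aN < bN`. [folklore] -/
theorem not_bothSides (hN : 1 ≤ N) {v : ℝ → ℝ≥0∞} (hE : periodicGroundStateEnergy v N L ≠ ⊤) {a b : ℝ}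
    (hab : a < b)
    (hP : ∃ δ : ℝ≥0∞, 0 < δ ∧ ∀ Ψ : PeriodicTrialState N L,
      periodicEnergy v Ψ ≤ periodicGroundStateEnergy v N L + δ →
      b * N ≤ (condensateOccupation N L Ψ.ψ).toReal)
    (hQ : ∃ δ : ℝ≥0∞, 0 < δ ∧ ∀ Ψ : PeriodicTrialState N L,
      periodicEnergy v Ψ ≤ periodicGroundStateEnergy v N L + δ →
      (condensateOccupation N L Ψ.ψ).toReal ≤ a * N) : False := by
  obtain ⟨δP, hδP, hP⟩ := hP
  obtain ⟨δQ, hδQ, hQ⟩ := hQ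
  obtain ⟨Ψ, hΨ⟩ := exists_nearMinimiser_of_slack_ne_zero v hE (min δP δQ) (lt_min hδP hδQ).ne'
  have h1 := hP Ψ (hΨ.trans (add_le_add le_rfl (min_le_left _ _)))
  have h2 := hQ Ψ (hΨ.trans (add_le_add le_rfl (min_le_right _ _)))
  have hNpos : (0 : ℝ) < N := by exact_mod_cast hN
  have hbaN : 0 < (b - a) * N := mul_pos (sub_pos.2 hab) hNpos
  linarith

/-! ## The free anchor -/

/-- **Depletion costs kinetic energy at the gap rate** (every `N`, `L > 0`, every `v ≥ 0`):
`N ≤ ⟨Ψ, n₀Ψ⟩ + (L²/4π²) ⟨Ψ, HΨ⟩` — Parseval `∑_p n_p = N`, the gradient identity `∑_p |2πp/L|² n_p = ∫|∇Ψ|²`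
and `|2πp/L|² ≥ 4π²/L²` for `p ≠ 0`. [folklore] -/
theorem natCast_le_condensateOccupation_add_energy (hL : 0 < L) (v : ℝ → ℝ≥0∞) (Ψ : PeriodicTrialState N L) :
    (N : ℝ≥0∞) ≤ condensateOccupation N L Ψ.ψ +
      ENNReal.ofReal (L ^ 2 / (4 * Real.pi ^ 2)) * periodicEnergy v Ψ := by
  set K : ℝ≥0∞ := ENNReal.ofReal (L ^ 2 / (4 * Real.pi ^ 2)) with hK
  -- one kinetic quantum bounds each non-zero mode
  have hterm : ∀ p : Fin 3 → ℤ, p ≠ 0 → cellOccupation N L (planeWaveMode L p) Ψ.ψ ≤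
      K * (fracDispersion 2 L p * cellOccupation N L (planeWaveMode L p) Ψ.ψ) := by
    intro p hp
    rw [← mul_assoc]
    refine le_mul_of_one_le_left bot_le ?_
    obtain ⟨k, hk⟩ : ∃ k, p k ≠ 0 := Function.ne_iff.1 hp
    have hsum : (1 : ℝ) ≤ ∑ j, ((p j : ℤ) : ℝ) ^ 2 := by
      have habs : (1 : ℝ) ≤ |((p k : ℤ) : ℝ)| := by exact_mod_cast Int.one_le_abs hk
      have h1 : (1 : ℝ) ≤ ((p k : ℤ) : ℝ) ^ 2 := by
        nlinarith [abs_nonneg ((p k : ℤ) : ℝ), sq_abs ((p k : ℤ) : ℝ)]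
      exact h1.trans (Finset.single_le_sum (fun j _ => sq_nonneg (((p j : ℤ) : ℝ))) (Finset.mem_univ k))
    rw [hK, fracDispersion_two, ← ENNReal.ofReal_mul (by positivity), ← ENNReal.ofReal_one]
    refine ENNReal.ofReal_le_ofReal ?_
    have hπ : 0 < Real.pi := Real.pi_pos
    calc (1 : ℝ) ≤ ∑ j, ((p j : ℤ) : ℝ) ^ 2 := hsum
      _ = L ^ 2 / (4 * Real.pi ^ 2) * (4 * Real.pi ^ 2 * (∑ j, ((p j : ℤ) : ℝ) ^ 2) / L ^ 2) := by
          field_simp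
  refine (Ψ.tsum_cellOccupation_planeWaveMode hL).symm.le.trans ?_
  rw [ENNReal.tsum_eq_add_tsum_ite (0 : Fin 3 → ℤ), cellOccupation_planeWaveMode_zero]
  refine add_le_add le_rfl ?_
  calc _ ≤ ∑' p : Fin 3 → ℤ, K * (fracDispersion 2 L p * cellOccupation N L (planeWaveMode L p) Ψ.ψ) := by
        refine ENNReal.tsum_le_tsum fun p => ?_
        split_ifs with hp
        · exact bot_le
        · exact hterm p hp
    _ = K * ∫⁻ X in cellN N L, kineticDensity Ψ.ψ X := by
        rw [ENNReal.tsum_mul_left, tsum_fracDispersion_two_mul_cellOccupation hL Ψ]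
    _ ≤ K * periodicEnergy v Ψ := by
        gcongr
        exact lintegral_mono fun X => le_self_add

/-- **The free anchor** (`t = 0`): for the zero potential `E₀^per = 0`, and every state of energy
`≤ 4π²(1 - b)N/L²` has `n₀ ≥ bN` (`b < 1`, `N ≥ 1`). Stated for any `v` equal to `0`. [folklore] -/
theorem anchor (hN : 1 ≤ N) (hL : 0 < L) {b : ℝ} (hb : b < 1) (v : ℝ → ℝ≥0∞) (hv : v = 0) :
    ∃ δ : ℝ≥0∞, 0 < δ ∧ ∀ Ψ : PeriodicTrialState N L,
      periodicEnergy v Ψ ≤ periodicGroundStateEnergy v N L + δ →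
      b * N ≤ (condensateOccupation N L Ψ.ψ).toReal := by
  subst hv
  rw [periodicGroundStateEnergy_zero_eq_zero N hL]
  have hNpos : (0 : ℝ) < N := by exact_mod_cast hN
  have hbN : 0 < (1 - b) * N := mul_pos (sub_pos.2 hb) hNpos
  set K : ℝ := L ^ 2 / (4 * Real.pi ^ 2) with hK
  have hKpos : 0 < K := by positivity
  refine ⟨ENNReal.ofReal ((1 - b) * N / K), ENNReal.ofReal_pos.2 (by positivity), fun Ψ hΨ => ?_⟩
  rw [zero_add] at hΨ
  obtain ⟨hfin, -⟩ := condensateOccupation_ne_top_and_toReal_le hL Ψ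
  have h2 : ENNReal.ofReal K * periodicEnergy 0 Ψ ≤ ENNReal.ofReal ((1 - b) * N) := by
    calc ENNReal.ofReal K * periodicEnergy 0 Ψ
        ≤ ENNReal.ofReal K * ENNReal.ofReal ((1 - b) * N / K) := by gcongr
      _ = ENNReal.ofReal ((1 - b) * N) := by
          rw [← ENNReal.ofReal_mul hKpos.le]
          congr 1
          field_simp
  have h3 : (N : ℝ≥0∞) ≤ condensateOccupation N L Ψ.ψ + ENNReal.ofReal ((1 - b) * N) :=
    (natCast_le_condensateOccupation_add_energy hL 0 Ψ).trans (add_le_add le_rfl h2)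
  have h4 := ENNReal.toReal_mono (ENNReal.add_ne_top.2 ⟨hfin, ENNReal.ofReal_ne_top⟩) h3
  rw [ENNReal.toReal_natCast, ENNReal.toReal_add hfin ENNReal.ofReal_ne_top,
    ENNReal.toReal_ofReal hbN.le] at h4
  linarith

/-! ## Assembly -/

/-- **Coupling-continuity selection** (S5-C2) at fixed `N ≥ 1`, `L > 0`, for an admissible integrable `w` and
thresholds `a < b < 1`: if along `t ↦ t·w` near-minimisers are transported (`htr`, the content of the
neighbouring stub S5-C1) and the condensate dichotomy `n₀ ≤ aN ∨ n₀ ≥ bN` holds for the near-minimisers of every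
`H_t`, `t ∈ [0,1]`, then at some slack every near-minimiser of `H_w` has `n₀ ≥ bN`. [folklore] -/
theorem couplingSelect (hN : 1 ≤ N) (hL : 0 < L) {w : ℝ → ℝ≥0∞} (hw : IsRepulsiveFiniteRange w)
    (hint : (∫⁻ x : Space, w ‖x‖) ≠ ⊤) {a b : ℝ} (hab : a < b) (hb1 : b < 1)
    (htr : ∀ t : ℝ, t ∈ Set.Icc (0 : ℝ) 1 → ∀ ε : ℝ≥0∞, 0 < ε → ∃ θ : ℝ, 0 < θ ∧ ∃ δ' : ℝ≥0∞, 0 < δ' ∧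
      ∀ t' : ℝ, t' ∈ Set.Icc (0 : ℝ) 1 → |t' - t| < θ → ∀ Ψ : PeriodicTrialState N L,
        periodicEnergy (fun r => ENNReal.ofReal t' * w r) Ψ ≤
            periodicGroundStateEnergy (fun r => ENNReal.ofReal t' * w r) N L + δ' →
          periodicEnergy (fun r => ENNReal.ofReal t * w r) Ψ ≤
            periodicGroundStateEnergy (fun r => ENNReal.ofReal t * w r) N L + ε)
    (hdich : ∀ t : ℝ, t ∈ Set.Icc (0 : ℝ) 1 → ∃ δ : ℝ≥0∞, 0 < δ ∧ ∀ Ψ : PeriodicTrialState N L,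
      periodicEnergy (fun r => ENNReal.ofReal t * w r) Ψ ≤
          periodicGroundStateEnergy (fun r => ENNReal.ofReal t * w r) N L + δ →
        (condensateOccupation N L Ψ.ψ).toReal ≤ a * N ∨ b * N ≤ (condensateOccupation N L Ψ.ψ).toReal) :
    ∃ δ : ℝ≥0∞, 0 < δ ∧ ∀ Ψ : PeriodicTrialState N L,
      periodicEnergy w Ψ ≤ periodicGroundStateEnergy w N L + δ →
      b * N ≤ (condensateOccupation N L Ψ.ψ).toReal := by
  have hwt : ∀ t : ℝ, IsRepulsiveFiniteRange (fun r => ENNReal.ofReal t * w r) :=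
    isRepulsiveFiniteRange_ofReal_mul hw
  have hintt : ∀ t : ℝ, (∫⁻ x : Space, (fun r => ENNReal.ofReal t * w r) ‖x‖) ≠ ⊤ :=
    lintegral_ofReal_mul_ne_top hw.1 hint
  have hP1 := icc_select
    (P := fun t => ∃ δ : ℝ≥0∞, 0 < δ ∧ ∀ Ψ : PeriodicTrialState N L,
      periodicEnergy (fun r => ENNReal.ofReal t * w r) Ψ ≤
          periodicGroundStateEnergy (fun r => ENNReal.ofReal t * w r) N L + δ →
        b * N ≤ (condensateOccupation N L Ψ.ψ).toReal)
    (Q := fun t => ∃ δ : ℝ≥0∞, 0 < δ ∧ ∀ Ψ : PeriodicTrialState N L,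
      periodicEnergy (fun r => ENNReal.ofReal t * w r) Ψ ≤
          periodicGroundStateEnergy (fun r => ENNReal.ofReal t * w r) N L + δ →
        (condensateOccupation N L Ψ.ψ).toReal ≤ a * N)
    (fun t ht => oneSide hN hL (hwt t) (hintt t) hab (hdich t ht))
    (fun t _ hp hq => not_bothSides hN (groundStateEnergy_ne_top hN hL (hwt t) (hintt t)) hab hp hq)
    (fun t ht ⟨δ, hδ, hPδ⟩ => by
      obtain ⟨θ, hθ, δ', hδ', h⟩ := htr t ht δ hδ
      exact ⟨θ, hθ, fun t' ht' hdist => ⟨δ', hδ', fun Ψ hΨ => hPδ Ψ (h t' ht' hdist Ψ hΨ)⟩⟩)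
    (fun t ht ⟨δ, hδ, hQδ⟩ => by
      obtain ⟨θ, hθ, δ', hδ', h⟩ := htr t ht δ hδ
      exact ⟨θ, hθ, fun t' ht' hdist => ⟨δ', hδ', fun Ψ hΨ => hQδ Ψ (h t' ht' hdist Ψ hΨ)⟩⟩)
    (anchor hN hL hb1 _ (funext fun r => by rw [ENNReal.ofReal_zero, zero_mul, Pi.zero_apply]))
  have h1 : (fun r => ENNReal.ofReal 1 * w r) = w := funext fun r => by rw [ENNReal.ofReal_one, one_mul]
  rw [h1] at hP1
  exact hP1

end CouplingSelect

/-- **Registered helper sub-goal `stub_fsumCouplingSelect`** (line `fsum-phase-pencil`, S5-C2), verbatim: the path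
transport (C1) implies the coupling-continuity selection (C) (`CouplingSelect.couplingSelect`). [folklore] -/
theorem stub_fsumCouplingSelect : (∀ {N : ℕ} {L : ℝ}, 0 < L → ∀ {w : ℝ → ℝ≥0∞}, Measurable w → (∫⁻ x : Space, w ‖x‖) ≠ ⊤ → ∀ t : ℝ, t ∈ Set.Icc (0 : ℝ) 1 → ∀ ε : ℝ≥0∞, 0 < ε → ∃ θ : ℝ, 0 < θ ∧ ∃ δ' : ℝ≥0∞, 0 < δ' ∧ ∀ t' : ℝ, t' ∈ Set.Icc (0 : ℝ) 1 → |t' - t| < θ → ∀ Ψ : PeriodicTrialState N L, periodicEnergy (fun r => ENNReal.ofReal t' * w r) Ψ ≤ periodicGroundStateEnergy (fun r => ENNReal.ofReal t' * w r) N L + δ' → periodicEnergy (fun r => ENNReal.ofReal t * w r) Ψ ≤ periodicGroundStateEnergy (fun r => ENNReal.ofReal t * w r) N L + ε) → (∀ {N : ℕ} {L : ℝ}, 1 ≤ N → 0 < L → ∀ {w : ℝ → ℝ≥0∞}, IsRepulsiveFiniteRange w → (∫⁻ x : Space, w ‖x‖) ≠ ⊤ → ∀ {a b : ℝ}, a <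 b → b < 1 → (∀ t : ℝ, t ∈ Set.Icc (0 : ℝ) 1 → ∃ δ : ℝ≥0∞, 0 < δ ∧ ∀ Ψ : PeriodicTrialState N L, periodicEnergy (fun r => ENNReal.ofReal t * w r) Ψ ≤ periodicGroundStateEnergy (fun r => ENNReal.ofReal t * w r) N L + δ → (condensateOccupation N L Ψ.ψ).toReal ≤ a * N ∨ b * N ≤ (condensateOccupation N L Ψ.ψ).toReal) → ∃ δ : ℝ≥0∞, 0 < δ ∧ ∀ Ψ : PeriodicTrialState N L, periodicEnergy w Ψ ≤ periodicGroundStateEnergy w N L + δ → b * N ≤ (condensateOccupation N L Ψ.ψ).toReal) := by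
  intro hC1 N L hN hL w hw hint a b hab hb1 hdich
  exact CouplingSelect.couplingSelect hN hL hw hint hab hb1 (hC1 hL hw.1 hint) hdich

end Summit.AtomisticToContinuum.BoseEinsteinCondensation.Cruxes.PeriodicIRBound.FsumPhasePencil

end
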